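import Literature.AlgebraicGeometry.HodgeTheory.MonomialSupportedHypersurfaceMonodromy
import Literature.AlgebraicGeometry.HodgeTheory.MonomialSupportedHypersurfaceFamilyPoints
import Literature.AlgebraicGeometry.HodgeTheory.MonomialSupportedHypersurfaceInvariantCycles
import Literature.AlgebraicGeometry.HodgeTheory.DiagonalCharacterEigenspace
import Literature.AlgebraicGeometry.HodgeTheory.VanishingCohomologyNontrivialProofs
import HarnessLib

/-!
# Equivariant Ehresmann for monomial-supported hypersurface families: the eigenspace dimensions of a diagonal
# symmetry are constant (Voisin I Thm. 9.3 / §9.2.1; Katz 2009 §3 "the eigensheaves are local systems")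

Family `hodge`, layer `Literature/AlgebraicGeometry/HodgeTheory`. PROOF FILE (theorems only: no definition, no named
fact, no instance; D-0026 net debt `0`). Let `M` be a set of degree-`d` monomials in `x₀, …, x_{n+1}` and
`γ ∈ (ℂˣ)ⁿ⁺²` a diagonal transformation fixing every monomial of `M` (`FixesMonomials`), so that `γ` is a diagonal
symmetry of EVERY `M`-supported form. C. Voisin, *Hodge Theory and Complex Algebraic Geometry I* (2002), Thm. 9.3 and
§9.2.1: the cohomology of the fibres of a smooth proper family forms a local system, trivialised along paths
(Ehresmann); N. M. Katz, *Another look at the Dwork family* (2009), §3 and Lemma 3.1(1): when a group acts on the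
family OVER THE BASE, "the eigensheaves are local systems" — parallel transport commutes with the fibrewise action, so
the eigenspaces of the action are transported onto each other and their ranks are constant on the connected base.

The tree has all the ingredients: the `M`-supported family `π_M : 𝒴_M → S_M` (`Motives/MonomialSupportedHypersurfaceFamily`;
smooth projective, cohomologically locally trivial on all of `S_M(ℂ)` — `isCohomologicallyLocallyTrivialOn_familyM`;
`S_M(ℂ)` path connected — `pathConnectedSpace_complexPoints_baseM`), its relative diagonal automorphism `σ_γ` over
the base with fibre maps conjugate to `diagonalAut` under the embedding-compatible fibre isomorphisms
(`sigmaMFiber_comp_eq_diagonalAut`), and the naturality of transport under endomorphisms over the base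
(`transportFun_map_fiberHom`). This file assembles them (the pattern of `DworkSexticEquivariantTransport`, for ONE
symmetry and an ARBITRARY path-connected monomial family):

* `exists_equivariant_transport_of_fiberHom` — abstract: a family `π`, a path in the locally trivial locus, an
  endomorphism `G` of the total space over the base with fibre maps `gf t`, and fibre isomorphisms conjugating
  `gf sᵢ` to self-maps `σᵢ` of `Xᵢ` give an injective `ℂ`-linear `T : Hᵏ(X₁(ℂ); ℂ) → Hᵏ(X₂(ℂ); ℂ)` with
  `T ∘ σ₁^* = σ₂^* ∘ T`.
* `finrank_eigenspace_le_of_injective_of_comm` — linear algebra: an injective intertwiner does not decrease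
  eigenspace dimensions.
* **`finrank_eigenspace_diagonalPullback_eq_of_isSupportedOn`** — for nonsingular `M`-supported forms `F`, `G` of
  degree `d ≥ 1` in `n + 2 ≥ 3` variables with `X_F`, `X_G` smooth projective and `γ` fixing `M`:
  `dim ker (g_{γ,F}^* − μ) = dim ker (g_{γ,G}^* − μ)` on `Hᵏ(·(ℂ); ℂ)` for every `k` and `μ`.

Written by the prover seat `hodge-nonav-19716-p2` (g5, cell `hodge-nonav`) as step F3 of the discharge, modulo the
geometric genus, of the binder hV of crux K1-B `VeryGeneralSignCommutatorsInHg` (route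
`HodgeConjecture/SignSymmetricPowers`): the `±1`-eigenspace dimensions of the sign involution on `H³` of a smooth
`ι`-even quinary form equal those of the Fermat threefold.

## References

* [VoisinHodgeI2002] C. Voisin, Hodge Theory and Complex Algebraic Geometry I, CUP 2002, Thm. 9.3, §9.2.1.
* [VoisinHodgeII2003] C. Voisin, Hodge Theory and Complex Algebraic Geometry II, CUP 2003, §3.1.2, §6.2.1.
* [Katz2009] N. M. Katz, Another look at the Dwork family, Progr. Math. 269 (2009), §3 p. 92, Lemma 3.1(1).
-/

noncomputable section

open CategoryTheory AlgebraicGeometry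

namespace Literature.AlgebraicGeometry.HodgeTheory

open Literature.AlgebraicGeometry.Motives Literature.AlgebraicTopology.SingularHomology
open Literature.AlgebraicGeometry.Motives.UniversalHypersurface
open Literature.AlgebraicGeometry.HodgeTheory.UniversalHypersurface

/-! ### Equivariant transport along a path, for one endomorphism over the base -/

section Family

variable {𝒳 S : SchemeOver ℂ} (π : 𝒳 ⟶ S) {U : Set (ComplexPoints S)}
  (hU : IsCohomologicallyLocallyTrivialOn π U) {s₁ s₂ : U} (γ : Path.Homotopic.Quotient s₁ s₂) (k : ℕ)
  (G : 𝒳 ⟶ 𝒳) (hG : G ≫ π = π)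
  (gf : ∀ t : ComplexPoints S, fiberOver π t ⟶ fiberOver π t)
  (hgf : ∀ t, gf t ≫ fiberι π t = fiberι π t ≫ G)
  {X₁ X₂ : SchemeOver ℂ} (e₁ : fiberOver π s₁.1 ≅ X₁) (e₂ : fiberOver π s₂.1 ≅ X₂)
  {σ₁ : X₁ ⟶ X₁} {σ₂ : X₂ ⟶ X₂}
  (he₁ : gf s₁.1 ≫ e₁.hom = e₁.hom ≫ σ₁) (he₂ : gf s₂.1 ≫ e₂.hom = e₂.hom ≫ σ₂)

include hU γ hG hgf he₁ he₂ in
/-- **Equivariant transport along a path.** Given a family `π : 𝒳 ⟶ S`, cohomologically locally trivial over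
`U ∋ s₁, s₂`, a (homotopy class of a) path `γ` from `s₁` to `s₂` in `U`, an endomorphism `G` of `𝒳` over `S` with
fibre maps `gf t`, and isomorphisms `eᵢ : 𝒳_{sᵢ} ≅ Xᵢ` conjugating `gf sᵢ` to `σᵢ : Xᵢ ⟶ Xᵢ`: the map
`T = (e₂⁻¹)^* ∘ γ_* ∘ e₁^* : Hᵏ(X₁(ℂ); ℂ) → Hᵏ(X₂(ℂ); ℂ)` is `ℂ`-linear, injective (transport back along `γ⁻¹`)
and intertwines `σ₁^*` with `σ₂^*` (transport commutes with endomorphisms over the base,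
`transportFun_map_fiberHom`). [cite: Katz2009, §3 p. 92 and Lemma 3.1(1)] [cite: VoisinHodgeII2003, §3.1.2]
[cite: VoisinHodgeI2002, §9.2.1] -/
theorem exists_equivariant_transport_of_fiberHom :
    ∃ T : complexBetti X₁ k →ₗ[ℂ] complexBetti X₂ k, Function.Injective T ∧
      ∀ c, T (complexBetti.map σ₁ k c) = complexBetti.map σ₂ k (T c) := by
  refine ⟨(complexBetti.map e₂.inv k).hom ∘ₗ transportLinear π k hU γ ∘ₗ (complexBetti.map e₁.hom k).hom, ?_,
    fun c => ?_⟩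
  · -- injectivity: each factor has a left inverse
    have hca : ∀ {A B C : SchemeOver ℂ} (f : A ⟶ B) (g : B ⟶ C) (x : complexBetti C k),
        complexBetti.map (f ≫ g) k x = complexBetti.map f k (complexBetti.map g k x) := fun f g x => by
      rw [complexBetti.map_comp, ModuleCat.comp_apply]
    have h₁ : Function.Injective (complexBetti.map e₁.hom k) := fun x y hxy => by
      have h := congrArg (complexBetti.map e₁.inv k) hxy
      rwa [← hca, ← hca, e₁.inv_hom_id, complexBetti.map_id, ModuleCat.id_apply, ModuleCat.id_apply] at h
    have h₂ : Function.Injective (transportFun π k hU γ) := fun x y hxy => by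
      have h := congrArg (transportFun π k hU γ.symm) hxy
      rwa [← transportFun_trans, ← transportFun_trans, Path.Homotopic.Quotient.trans_symm,
        transportFun_refl, transportFun_refl] at h
    have h₃ : Function.Injective (complexBetti.map e₂.inv k) := fun x y hxy => by
      have h := congrArg (complexBetti.map e₂.hom k) hxy
      rwa [← hca, ← hca, e₂.hom_inv_id, complexBetti.map_id, ModuleCat.id_apply, ModuleCat.id_apply] at h
    intro x y hxy
    simp only [LinearMap.coe_comp, Function.comp_apply, transportLinear_apply] at hxy
    exact h₁ (h₂ (h₃ hxy))
  · -- equivariance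
    have hca : ∀ {A B C : SchemeOver ℂ} (f : A ⟶ B) (g : B ⟶ C) (x : complexBetti C k),
        complexBetti.map (f ≫ g) k x = complexBetti.map f k (complexBetti.map g k x) := fun f g x => by
      rw [complexBetti.map_comp, ModuleCat.comp_apply]
    simp only [LinearMap.coe_comp, Function.comp_apply, transportLinear_apply]
    have hcomm : e₂.inv ≫ gf s₂.1 = σ₂ ≫ e₂.inv := by
      rw [Iso.inv_comp_eq, ← Category.assoc, ← he₂, Category.assoc, Iso.hom_inv_id, Category.comp_id]
    rw [← hca, ← he₁, hca, transportFun_map_fiberHom π k hU G hG gf hgf γ, ← hca, ← hca, hcomm]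

end Family

/-! ### An injective intertwiner does not decrease eigenspace dimensions -/

/-- **Linear algebra**: if `T : V → W` is injective with `T ∘ A = B ∘ T`, then `T` maps `ker (A − μ)` injectively into
`ker (B − μ)`, so `dim ker (A − μ) ≤ dim ker (B − μ)` (`W` finite-dimensional). [folklore] -/
private theorem finrank_eigenspace_le_of_injective_of_comm {V W : Type*} [AddCommGroup V] [Module ℂ V] [AddCommGroup W]
    [Module ℂ W] [FiniteDimensional ℂ W] (T : V →ₗ[ℂ] W) (hT : Function.Injective T) (A : Module.End ℂ V)
    (B : Module.End ℂ W) (h : ∀ v, T (A v) = B (T v)) (μ : ℂ) :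
    Module.finrank ℂ ↥(Module.End.eigenspace A μ) ≤ Module.finrank ℂ ↥(Module.End.eigenspace B μ) := by
  have hmaps : ∀ v ∈ Module.End.eigenspace A μ, T v ∈ Module.End.eigenspace B μ := by
    intro v hv
    rw [Module.End.mem_eigenspace_iff] at hv ⊢
    rw [← h, hv, map_smul]
  refine LinearMap.finrank_le_finrank_of_injective (f := (T.domRestrict _).codRestrict _ fun v => hmaps v.1 v.2) ?_
  intro v w hvw
  apply Subtype.ext
  apply hT
  simpa using congrArg Subtype.val hvw

/-! ### The eigenspace dimensions of `γ` are constant on the `M`-supported family -/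

section Constancy

variable {n d : ℕ} (M : Set (DegIndex n d)) {γ : Fin (n + 2) → ℂˣ}

/-- Fibre isomorphisms of the `M`-supported family over the point of a form `G`, typed against `X_G` itself and
compatible with the embeddings into `ℙⁿ⁺¹` (`exists_fiberIsoM_comp_hypersurfaceι` with `pointFormM [G] = G`).
[cite: VoisinHodgeII2003, §6.2.1] -/
theorem exists_fiberIsoM_of_eq (hd : 0 < d) (t : AlgPoints (baseM ℂ n d M) ℂ)
    {G : MvPolynomial (Fin (n + 2)) ℂ} (hG : pointFormM ℂ n d M t = G) :
    ∃ e : fiberOver (familyM ℂ n d M) t ≅ SmoothHypersurface.hypersurface G,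
      e.hom ≫ SmoothHypersurface.hypersurfaceι G = fiberToProjectiveSpace ℂ n d M t := by
  subst hG
  exact exists_fiberIsoM_comp_hypersurfaceι ℂ n d M hd t

/-- One direction of the constancy: an injective equivariant transport from `X_F` to `X_G` bounds the eigenspace
dimensions of `g_{γ,F}^*` by those of `g_{γ,G}^*`. [cite: Katz2009, §3 Lemma 3.1(1)] [cite: VoisinHodgeI2002, Thm. 9.3] -/
theorem finrank_eigenspace_diagonalPullback_le_of_isSupportedOn (hn : 1 ≤ n) (hd : 1 ≤ d)
    (hγ : FixesMonomials ℂ n d M γ) {F G : MvPolynomial (Fin (n + 2)) ℂ}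
    (hF : F.IsHomogeneous d) (hFJ : SmoothHypersurface.IsNonsingularForm ℂ F) (hFM : IsSupportedOn n d M F)
    (haF : γ ∈ diagonalStabilizer F)
    (hG : G.IsHomogeneous d) (hGJ : SmoothHypersurface.IsNonsingularForm ℂ G) (hGM : IsSupportedOn n d M G)
    (haG : γ ∈ diagonalStabilizer G) (hXG : IsSmoothProjective n (SmoothHypersurface.hypersurface G))
    (k : ℕ) (μ : ℂ) :
    Module.finrank ℂ ↥(Module.End.eigenspace (diagonalPullback F haF k) μ) ≤
      Module.finrank ℂ ↥(Module.End.eigenspace (diagonalPullback G haG k) μ) := by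
  -- the two points of `S_M(ℂ)` and a path between them
  set t₁ : AlgPoints (baseM ℂ n d M) ℂ := pointOfFormM ℂ n d M hF hFJ hFM with ht₁
  set t₂ : AlgPoints (baseM ℂ n d M) ℂ := pointOfFormM ℂ n d M hG hGJ hGM with ht₂
  haveI := pathConnectedSpace_complexPoints_baseM n d M t₁
  let γ₀ : Path t₁ t₂ := PathConnectedSpace.somePath t₁ t₂
  let s₁ : (Set.univ : Set (ComplexPoints (baseM ℂ n d M))) := ⟨t₁, trivial⟩
  let s₂ : (Set.univ : Set (ComplexPoints (baseM ℂ n d M))) := ⟨t₂, trivial⟩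
  let γ' : Path s₁ s₂ :=
    { toFun := fun u => ⟨γ₀ u, trivial⟩
      continuous_toFun := γ₀.continuous.subtype_mk _
      source' := Subtype.ext γ₀.source
      target' := Subtype.ext γ₀.target }
  -- fibre isomorphisms compatible with the embeddings, conjugating `σ_{γ,t}` to `diagonalAut`
  obtain ⟨e₁, he₁⟩ := exists_fiberIsoM_of_eq M hd t₁ (pointFormM_pointOfFormM ℂ n d M hF hFJ hFM)
  obtain ⟨e₂, he₂⟩ := exists_fiberIsoM_of_eq M hd t₂ (pointFormM_pointOfFormM ℂ n d M hG hGJ hGM)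
  obtain ⟨T, hTinj, hT⟩ := exists_equivariant_transport_of_fiberHom (familyM ℂ n d M)
    (isCohomologicallyLocallyTrivialOn_familyM n d M hn hd) (s₁ := s₁) (s₂ := s₂) ⟦γ'⟧ k
    (sigmaM ℂ n d M γ hγ) (sigmaM_comp_familyM ℂ n d M γ hγ) (fun t => sigmaMFiber ℂ n d M γ hγ t)
    (fun t => sigmaMFiber_comp_fiberι ℂ n d M γ hγ t) e₁ e₂
    (sigmaMFiber_comp_eq_diagonalAut n d M γ hγ t₁ e₁ he₁ haF)
    (sigmaMFiber_comp_eq_diagonalAut n d M γ hγ t₂ e₂ he₂ haG)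
  haveI := finite_complexBetti hXG k
  exact finrank_eigenspace_le_of_injective_of_comm T hTinj _ _ (fun c => hT c) μ

/-- **The eigenspace dimensions of a diagonal symmetry are constant on the `M`-supported family** (equivariant
Ehresmann; Katz: "the eigensheaves are local systems"): for nonsingular `M`-supported forms `F`, `G` of degree
`d ≥ 1` in `n + 2 ≥ 3` variables cutting out smooth projective `X_F`, `X_G`, and `γ ∈ (ℂˣ)ⁿ⁺²` fixing the monomials
of `M` (hence a diagonal symmetry of both), the `μ`-eigenspaces of `g_{γ,F}^*` on `Hᵏ(X_F(ℂ); ℂ)` and of `g_{γ,G}^*` on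
`Hᵏ(X_G(ℂ); ℂ)` have the same dimension, for every `k` and every `μ ∈ ℂ`.
[cite: Katz2009, §3 p. 92 and Lemma 3.1(1)] [cite: VoisinHodgeI2002, Thm. 9.3 and §9.2.1] [cite: VoisinHodgeII2003, §3.1.2] -/
theorem finrank_eigenspace_diagonalPullback_eq_of_isSupportedOn (hn : 1 ≤ n) (hd : 1 ≤ d)
    (hγ : FixesMonomials ℂ n d M γ) {F G : MvPolynomial (Fin (n + 2)) ℂ}
    (hF : F.IsHomogeneous d) (hFJ : SmoothHypersurface.IsNonsingularForm ℂ F) (hFM : IsSupportedOn n d M F)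
    (haF : γ ∈ diagonalStabilizer F) (hXF : IsSmoothProjective n (SmoothHypersurface.hypersurface F))
    (hG : G.IsHomogeneous d) (hGJ : SmoothHypersurface.IsNonsingularForm ℂ G) (hGM : IsSupportedOn n d M G)
    (haG : γ ∈ diagonalStabilizer G) (hXG : IsSmoothProjective n (SmoothHypersurface.hypersurface G))
    (k : ℕ) (μ : ℂ) :
    Module.finrank ℂ ↥(Module.End.eigenspace (diagonalPullback F haF k) μ) =
      Module.finrank ℂ ↥(Module.End.eigenspace (diagonalPullback G haG k) μ) :=
  le_antisymm
    (finrank_eigenspace_diagonalPullback_le_of_isSupportedOn M hn hd hγ hF hFJ hFM haF hG hGJ hGM haG hXG k μ)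
    (finrank_eigenspace_diagonalPullback_le_of_isSupportedOn M hn hd hγ hG hGJ hGM haG hF hFJ hFM haF hXF k μ)

end Constancy

end Literature.AlgebraicGeometry.HodgeTheory

end
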